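import Mathlib
import HarnessLib
import Summits.QuantumFields.YangMills.Theorems.ComplexCouplingChannelContinuumLegGivenGapPtuAssemblyFarSum

/-!
# `ContinuumLegGivenGap` (stmt-QuantumFields-15828), line `alternating-curvature-arrays`: `stub_ptuAssembly`, the FAR pieces — the sum over one Whitney level and its factorial shape

Support file for `stub_ptuAssembly`, continuing `…PtuAssemblyFarSum`.
* `ptuLevel_theta_shape` (registered anchor) — the constant of the two regimes times the counting loss is of the (UUVB)
  shape: `Θ (2p+1)^4 c₁^p ≤ Ω₁^{p+1} (p+1)^{(s+16t+4)(p+1)}` with the explicit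
  `Ω₁ = 162 c' + W₁ W₂^t 2^{p₀+s+8} 240^{p₀+t+s+6} max(c₁,1)`, `W₁ = 2CK((s+1)2^s) c'^{s+1} (s+1)^{4s}`,
  `W₂ = 2c'(t+1)^8`, `c' = max c₂ 1`;
* `ptuLevel_sum_le` — the SUM OVER ONE LEVEL `m`: every piece `(v,z) ∈ ptuIdx` through `ptuFarSum_piece_small/large`,
  the decay weights summed by the counting bound of piece 1 at the box points, the regime dichotomy giving the common
  factor `min(ℓ, ℓ⁻¹)`:
  `∑_{(v,z)} ‖piece‖ ≤ Ω₁^{p+1} (p+1)^{(s+16t+4)(p+1)} · min(ℓ, ℓ⁻¹) · |F|_{p(2t+p₀+s+12)}`.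
No definitions. [folklore]
-/

set_option autoImplicit false

noncomputable section

open scoped Classical

namespace Summit.QuantumFields.YangMills.Theorems.ContinuumLegGivenGap

open scoped SchwartzMap BigOperators ContDiff
open MeasureTheory Filter Topology
open Literature.MathematicalPhysics.QuantumFieldTheory Literature.MathematicalPhysics.QuantumLattice
  Literature.MathematicalPhysics.AQFT
open Literature.Probability.LatticeModels (box Site)
open Summit.QuantumFields.YangMills.Cruxes.ContinuumLimitOnTrajectory.TwoOrbitSynchronisation
  (PlaqIdx plaq canonDistribution)
open Summit.QuantumFields.YangMills.Theorems.ContinuumLimitExists.Negative (centredMoment)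
open Summit.QuantumFields.YangMills.Theorems.ContinuumLegGivenGap.AlternatingArrays (cellSide cellNorm physCore)

/-! ## §1 The factorial shape of the level constant -/

/-- The product identity behind the shape of the level constant (all factors as atoms). [folklore] -/
theorem ptuLevel_step_identity (V1 V2 c' p1 b2 b240 d1 : ℝ) (p s t : ℕ) :
    (V1 * p1 ^ s) ^ p * c' * (V2 * p1 ^ 16) ^ (p * t) * (2 * b2 ^ p) * b240 ^ p * (81 * p1 ^ 4) * d1 ^ p =
      (162 * c') * (V1 * V2 ^ t * b2 * b240 * d1) ^ p * p1 ^ (s * p + 16 * (p * t) + 4) := by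
  ring

set_option maxHeartbeats 1000000 in
/-- **The shape of the level constant** (registered anchor): for `C, K ≥ 0`, `c₁ > 0` and all `c₂ p₀ s t p`,
`Θ (2p+1)^4 c₁^p ≤ Ω₁^{p+1} (p+1)^{(s+16t+4)(p+1)}`. [folklore] -/
theorem ptuLevel_theta_shape : ∀ (C K c₂ c₁ : ℝ) (p₀ s t p : ℕ), 0 ≤ C → 0 ≤ K → 0 < c₁ →
    ((2 * C * K * (((s : ℝ) + 1) * 2 ^ s * (max c₂ 1 * (max c₂ 1 * ((p : ℝ) + 1) * ((s : ℝ) + 1) ^ 4) ^ s))) ^ p * max c₂ 1 * (2 * (max c₂ 1 * ((p : ℝ) + 1) ^ 8 * ((p : ℝ) * t + 1) ^ 8)) ^ (p * t) * 2 ^ (6 * p + (p * (p₀ + s) + 2 * p) + 1) * (240 : ℝ) ^ (p * p₀ + p * t + p * (s + 6))) *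
        (2 * (p : ℝ) + 1) ^ 4 * c₁ ^ p ≤
      (162 * max c₂ 1 + (2 * C * K * (((s : ℝ) + 1) * 2 ^ s) * max c₂ 1 ^ (s + 1) * ((s : ℝ) + 1) ^ (4 * s)) * (2 * max c₂ 1 * ((t : ℝ) + 1) ^ 8) ^ t * 2 ^ (p₀ + s + 8) * (240 : ℝ) ^ (p₀ + t + s + 6) * max c₁ 1) ^ (p + 1) *
        ((p : ℝ) + 1) ^ ((s + 16 * t + 4) * (p + 1)) := by
  intro C K c₂ c₁ p₀ s t p hC hK hc₁
  -- atoms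
  set c' : ℝ := max c₂ 1 with hc'
  set p1 : ℝ := (p : ℝ) + 1 with hp1
  set s1 : ℝ := (s : ℝ) + 1 with hs1
  set t1 : ℝ := (t : ℝ) + 1 with ht1
  set d1 : ℝ := max c₁ 1 with hd1
  have hc1 : 1 ≤ c' := le_max_right _ _
  have hc0 : 0 ≤ c' := zero_le_one.trans hc1
  have hp1' : 1 ≤ p1 := by rw [hp1]; linarith [(Nat.cast_nonneg p : (0 : ℝ) ≤ p)]
  have hp0 : 0 ≤ p1 := zero_le_one.trans hp1'
  have hs0 : 0 ≤ s1 := by rw [hs1]; positivity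
  have ht1' : 1 ≤ t1 := by rw [ht1]; linarith [(Nat.cast_nonneg t : (0 : ℝ) ≤ t)]
  have hd1' : 1 ≤ d1 := le_max_right _ _
  have hcd : c₁ ≤ d1 := le_max_left _ _
  set V1 : ℝ := 2 * C * K * (s1 * 2 ^ s) * c' ^ (s + 1) * s1 ^ (4 * s) with hV1
  set V2 : ℝ := 2 * c' * t1 ^ 8 with hV2
  have hV1nn : 0 ≤ V1 := by positivity
  have hV2nn : 0 ≤ V2 := by positivity
  -- the components
  have hX0 : 2 * C * K * (s1 * 2 ^ s * (c' * (c' * p1 * s1 ^ 4) ^ s)) = V1 * p1 ^ s := by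
    rw [hV1]; ring
  have hpt : (p : ℝ) * t + 1 ≤ t1 * p1 := by
    rw [ht1, hp1]; nlinarith [(Nat.cast_nonneg p : (0 : ℝ) ≤ p), (Nat.cast_nonneg t : (0 : ℝ) ≤ t)]
  have hA8 : 2 * (c' * p1 ^ 8 * ((p : ℝ) * t + 1) ^ 8) ≤ V2 * p1 ^ 16 := by
    have h := pow_le_pow_left₀ (by positivity) hpt 8
    calc 2 * (c' * p1 ^ 8 * ((p : ℝ) * t + 1) ^ 8) ≤ 2 * (c' * p1 ^ 8 * (t1 * p1) ^ 8) := by gcongr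
      _ = V2 * p1 ^ 16 := by rw [hV2]; ring
  have h2 : (2 : ℝ) ^ (6 * p + (p * (p₀ + s) + 2 * p) + 1) = 2 * (2 ^ (p₀ + s + 8)) ^ p := by
    have he : 6 * p + (p * (p₀ + s) + 2 * p) + 1 = (p₀ + s + 8) * p + 1 := by ring
    rw [he, pow_succ, pow_mul]; ring
  have h240 : (240 : ℝ) ^ (p * p₀ + p * t + p * (s + 6)) = (240 ^ (p₀ + t + s + 6)) ^ p := by
    rw [← pow_mul]; congr 1; ring
  have h81 := ptuKit_two_mul_add_one_pow_four_le p
  -- opaque numeral powers for `ring`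
  set b2 : ℝ := 2 ^ (p₀ + s + 8) with hb2
  set b240 : ℝ := (240 : ℝ) ^ (p₀ + t + s + 6) with hb240
  set Ω : ℝ := 162 * c' + V1 * V2 ^ t * b2 * b240 * d1 with hΩ
  have hWnn : 0 ≤ V1 * V2 ^ t * b2 * b240 * d1 := by positivity
  have hΩ1 : 162 * c' ≤ Ω := by rw [hΩ]; linarith
  have hΩ2 : V1 * V2 ^ t * b2 * b240 * d1 ≤ Ω := by
    rw [hΩ]; linarith [mul_nonneg (by norm_num : (0 : ℝ) ≤ 162) hc0]
  have hΩ0 : 0 ≤ Ω := hWnn.trans hΩ2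
  have hexp : s * p + 16 * (p * t) + 4 ≤ (s + 16 * t + 4) * (p + 1) := by
    have : (s + 16 * t + 4) * (p + 1) = (s * p + 16 * (p * t) + 4) + (4 * p + s + 16 * t) := by ring
    rw [this]; exact Nat.le_add_right _ _
  rw [hX0, h2, h240]
  calc (V1 * p1 ^ s) ^ p * c' * (2 * (c' * p1 ^ 8 * ((p : ℝ) * t + 1) ^ 8)) ^ (p * t) *
        (2 * b2 ^ p) * b240 ^ p * (2 * (p : ℝ) + 1) ^ 4 * c₁ ^ p
      ≤ (V1 * p1 ^ s) ^ p * c' * (V2 * p1 ^ 16) ^ (p * t) * (2 * b2 ^ p) *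
        b240 ^ p * (81 * p1 ^ 4) * d1 ^ p := by gcongr
    _ = (162 * c') * (V1 * V2 ^ t * b2 * b240 * d1) ^ p *
        p1 ^ (s * p + 16 * (p * t) + 4) := ptuLevel_step_identity V1 V2 c' p1 b2 b240 d1 p s t
    _ ≤ Ω * Ω ^ p * p1 ^ ((s + 16 * t + 4) * (p + 1)) :=
        mul_le_mul (mul_le_mul hΩ1 (pow_le_pow_left₀ hWnn hΩ2 p) (by positivity) hΩ0)
          (pow_le_pow_right₀ hp1' hexp) (by positivity) (by positivity)
    _ = Ω ^ (p + 1) * p1 ^ ((s + 16 * t + 4) * (p + 1)) := by rw [pow_succ']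



/-! ## §2 The sum over one level -/

section Level

variable {G : Type} [Group G] [TopologicalSpace G] [IsTopologicalGroup G] [CompactSpace G]
  [MeasurableSpace G] [BorelSpace G]

set_option maxHeartbeats 1000000 in
/-- **The sum over one Whitney level.**  Every piece `(v, z) ∈ ptuIdx L_k m p` through `ptuFarSum_piece_small`
(`ℓ ≤ 1`) or `ptuFarSum_piece_large` (`ℓ > 1`); the decay weights `((1+‖g‖)⁶)⁻ᵖ` at the box points `g` summed by the
counting bound of piece 1 (`hcount`); in both regimes the `ℓ`-factors collapse to `min(ℓ, ℓ⁻¹)` and the constant is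
shaped by `ptuLevel_theta_shape`. [folklore] -/
theorem ptuLevel_sum_le (r : LatticeRep G) (sch : SpeciesScheme (YMSpecies G)) (k p : ℕ)
    (q : Fin p → PlaqIdx) (F : 𝓢((Fin p → EuclideanSpace ℝ (Fin 4)), ℂ)) (hF : IsOffDiagonal F) (m : ℕ)
    {C K c₂ c₁ : ℝ} {p₀ s t : ℕ} (hC : 0 ≤ C) (hK : 0 ≤ K) (hc₂ : 0 < c₂) (hc₁ : 0 < c₁) (hp : 1 ≤ p)
    (hLB : (∀ (G' : Type) [Group G'] [TopologicalSpace G'] [IsTopologicalGroup G'] [CompactSpace G'] [MeasurableSpace G']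
      [BorelSpace G'] (r : LatticeRep G') (sch : SpeciesScheme (YMSpecies G')) (k p : ℕ) (q : Fin p → PlaqIdx) (m : ℕ)
      (v : Fin 4 → ℤ) (z : Fin p → Fin 4 → ℤ) (C M : ℝ) (p₀ : ℕ) (χ : Fin p → 𝓢(EuclideanSpace ℝ (Fin 4), ℝ)),
      0 ≤ C → 0 ≤ M →
      (∀ (f : Fin p → 𝓢(EuclideanSpace ℝ (Fin 4), ℝ)) (F : 𝓢((Fin p → EuclideanSpace ℝ (Fin 4)), ℂ)),
        (∀ i, tsupport (f i) ⊆ physCore (sch.a k) m v (z i)) → IsTensorOf F (fun i => ofRealTest (f i)) →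
        ‖canonDistribution r sch k p (fun i => plaq r (q i)) F‖ ≤
          ∏ i, C * max (sch.a k * cellSide m) (sch.a k * cellSide m)⁻¹ ^ p₀ *
            cellNorm s (sch.a k * cellSide m) (f i)) →
      (∀ i, tsupport (χ i) ⊆ physCore (sch.a k) m v (z i)) →
      (∀ i, ∀ j ≤ s, ∀ y, (sch.a k * cellSide m) ^ j * ‖iteratedFDeriv ℝ j (χ i) y‖ ≤ M) →
      ∀ Gf : 𝓢((Fin p → EuclideanSpace ℝ (Fin 4)), ℂ),
        ‖∑ x : Fin p → ↥(box 4 (sch.L k)), (∏ i, ((χ i (sch.a k • siteToE (↑(x i) : Site 4)) : ℝ) : ℂ)) *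
            Gf (fun i => sch.a k • siteToE (↑(x i) : Site 4)) *
            ((centredMoment r (sch.L k) (sch.β k) p (fun i => some (q i)) (fun i => (x i : Site 4)) : ℝ) : ℂ)‖ ≤
          (2 * C * max (sch.a k * cellSide m) (sch.a k * cellSide m)⁻¹ ^ p₀ *
              ((s + 1) * 2 ^ s * M * max 1 (sch.a k * cellSide m) ^ s) * K) ^ p * schwartzNorm (p * t) Gf))
    (hFlat : (∀ (p n M K : ℕ) (F : 𝓢((Fin p → EuclideanSpace ℝ (Fin 4)), ℂ)), IsOffDiagonal F →
        ∀ (w : (Fin p → EuclideanSpace ℝ (Fin 4)) → ℝ) (A D δ d : ℝ), ContDiff ℝ ∞ w → HasCompactSupport w →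
          0 ≤ A → 0 ≤ D → 0 ≤ δ → 0 ≤ d →
          (∀ i ≤ n, ∀ y : (Fin p → EuclideanSpace ℝ (Fin 4)), ‖iteratedFDeriv ℝ i w y‖ ≤ A * D ^ i) →
          (∀ y ∈ tsupport w, ∃ i j : Fin p, i ≠ j ∧ ‖y i - y j‖ ≤ δ) →
          (∀ y ∈ tsupport w, d ≤ ‖y‖) →
          schwartzNorm n (SchwartzMap.smulLeftCLM ℂ (fun y : (Fin p → EuclideanSpace ℝ (Fin 4)) => ((w y : ℝ) : ℂ)) F) ≤
            A * (2 * max 1 D) ^ n * 2 ^ (K + 1) * δ ^ M * ((1 + d) ^ K)⁻¹ * schwartzNorm (n + M + K) F))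
    (hPBv : ∀ vz ∈ ptuIdx (sch.L k) m p, ∀ (f : Fin p → 𝓢(EuclideanSpace ℝ (Fin 4), ℝ)) (F' : 𝓢((Fin p → EuclideanSpace ℝ (Fin 4)), ℂ)),
      (∀ i, tsupport (f i) ⊆ physCore (sch.a k) m vz.1 (vz.2 i)) → IsTensorOf F' (fun i => ofRealTest (f i)) →
      ‖canonDistribution r sch k p (fun i => plaq r (q i)) F'‖ ≤
        ∏ i, C * max (sch.a k * cellSide m) (sch.a k * cellSide m)⁻¹ ^ p₀ * cellNorm s (sch.a k * cellSide m) (f i))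
    (hχsuppv : ∀ vz ∈ ptuIdx (sch.L k) m p, ∀ i : Fin p,
      tsupport (ptuChiFun (sch.a k) m p vz.1 (vz.2 i)) ⊆ physCore (sch.a k) m vz.1 (vz.2 i))
    (hχbdv : ∀ vz ∈ ptuIdx (sch.L k) m p, ∀ (i : Fin p) (j : ℕ) (u : EuclideanSpace ℝ (Fin 4)),
      (sch.a k * cellSide m) ^ j * ‖iteratedFDeriv ℝ j (ptuChiFun (sch.a k) m p vz.1 (vz.2 i)) u‖ ≤
        c₂ * (c₂ * ((p : ℝ) + 1) * ((j : ℝ) + 1) ^ 4) ^ j)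
    (hwCv : ∀ vz ∈ ptuIdx (sch.L k) m p, ContDiff ℝ ∞ (ptuWeight (sch.a k) (sch.L k) p m vz.1 vz.2))
    (hwKv : ∀ vz ∈ ptuIdx (sch.L k) m p, HasCompactSupport (ptuWeight (sch.a k) (sch.L k) p m vz.1 vz.2))
    (hwsuppv : ∀ vz ∈ ptuIdx (sch.L k) m p,
      tsupport (ptuWeight (sch.a k) (sch.L k) p m vz.1 vz.2) ⊆ tsupport (ptuPhiTilde (sch.a k) m p vz.1 vz.2))
    (hwbdv : ∀ vz ∈ ptuIdx (sch.L k) m p, ∀ (n : ℕ) (y : (Fin p → EuclideanSpace ℝ (Fin 4))),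
      ‖iteratedFDeriv ℝ n (ptuWeight (sch.a k) (sch.L k) p m vz.1 vz.2) y‖ ≤
        c₂ * (c₂ * ((p : ℝ) + 1) ^ 8 * ((n : ℝ) + 1) ^ 8 / (sch.a k * cellSide m)) ^ n)
    (hgeov : ∀ vz ∈ ptuIdx (sch.L k) m p, ∀ y : (Fin p → EuclideanSpace ℝ (Fin 4)), y ∈ tsupport (ptuPhiTilde (sch.a k) m p vz.1 vz.2) →
      (∃ i j : Fin p, i ≠ j ∧ ‖y i - y j‖ ≤ 240 * (sch.a k * cellSide m)) ∧
      ∀ (i : Fin p) (μ : Fin 4), sch.a k * ((vz.1 μ : ℝ) + cellSide m * (vz.2 i μ : ℝ)) ≤ y i μ ∧ y i μ ≤ sch.a k * ((vz.1 μ : ℝ) + cellSide m * ((vz.2 i μ : ℝ) + 1)))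
    (hsepv : ∀ vz ∈ ptuIdx (sch.L k) m p, ∃ i j : Fin p, i ≠ j ∧ (16 : ℝ) ≤ ‖vz.2 i - vz.2 j‖)
    (hcount : ∀ g : (Fin 4 → ℤ) × (Fin p → Fin 4 → ℤ) → (Fin p → EuclideanSpace ℝ (Fin 4)),
      (∀ vz ∈ ptuIdx (sch.L k) m p, ∀ (i : Fin p) (μ : Fin 4), sch.a k * ((vz.1 μ : ℝ) + cellSide m * (vz.2 i μ : ℝ)) ≤ g vz i μ ∧ g vz i μ ≤ sch.a k * ((vz.1 μ : ℝ) + cellSide m * ((vz.2 i μ : ℝ) + 1))) →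
      ∑ vz ∈ ptuIdx (sch.L k) m p, (((1 + ‖g vz‖) ^ 6)⁻¹) ^ p ≤
        (2 * (p : ℝ) + 1) ^ 4 * (c₁ * max 1 ((sch.a k * cellSide m)⁻¹ ^ 4)) ^ p) :
    ∑ vz ∈ ptuIdx (sch.L k) m p,
      ‖∑ x : Fin p → ↥(box 4 (sch.L k)),
          (∏ i, ((ptuChi (sch.a k) m p vz.1 (vz.2 i) (sch.a k • siteToE (↑(x i) : Site 4)) : ℝ) : ℂ)) *
            (SchwartzMap.smulLeftCLM ℂ
                (fun y : (Fin p → EuclideanSpace ℝ (Fin 4)) => ((ptuWeight (sch.a k) (sch.L k) p m vz.1 vz.2 y : ℝ) : ℂ)) F)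
              (fun i => sch.a k • siteToE (↑(x i) : Site 4)) *
            ((centredMoment r (sch.L k) (sch.β k) p (fun i => some (q i)) (fun i => (x i : Site 4)) : ℝ) : ℂ)‖ ≤
      (162 * max c₂ 1 + (2 * C * K * (((s : ℝ) + 1) * 2 ^ s) * max c₂ 1 ^ (s + 1) * ((s : ℝ) + 1) ^ (4 * s)) * (2 * max c₂ 1 * ((t : ℝ) + 1) ^ 8) ^ t * 2 ^ (p₀ + s + 8) * (240 : ℝ) ^ (p₀ + t + s + 6) * max c₁ 1) ^ (p + 1) *
        ((p : ℝ) + 1) ^ ((s + 16 * t + 4) * (p + 1)) * min (sch.a k * cellSide m) (sch.a k * cellSide m)⁻¹ * schwartzNorm (p * (2 * t + p₀ + s + 12)) F := by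
  have ha : 0 < sch.a k := sch.a_pos k
  have hshape := ptuLevel_theta_shape C K c₂ c₁ p₀ s t p hC hK hc₁
  -- the box points and the counting bound
  have hbox := hcount (fun vz => (fun i : Fin p => (WithLp.toLp 2 (fun μ : Fin 4 => max (sch.a k * ((vz.1 μ : ℝ) + cellSide m * (vz.2 i μ : ℝ))) (min 0 (sch.a k * ((vz.1 μ : ℝ) + cellSide m * ((vz.2 i μ : ℝ) + 1))))) : EuclideanSpace ℝ (Fin 4))))
    (fun vz _ i μ => ptuFar_boxPoint_mem ha.le m p vz.1 vz.2 i μ)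
  set ℓ : ℝ := sch.a k * cellSide m with hℓdef
  have hℓ : 0 < ℓ := ptuKit_ell_pos ha m
  set Θ : ℝ := ((2 * C * K * (((s : ℝ) + 1) * 2 ^ s * (max c₂ 1 * (max c₂ 1 * ((p : ℝ) + 1) * ((s : ℝ) + 1) ^ 4) ^ s))) ^ p * max c₂ 1 * (2 * (max c₂ 1 * ((p : ℝ) + 1) ^ 8 * ((p : ℝ) * t + 1) ^ 8)) ^ (p * t) * 2 ^ (6 * p + (p * (p₀ + s) + 2 * p) + 1) * (240 : ℝ) ^ (p * p₀ + p * t + p * (s + 6))) with hΘ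
  set Ω : ℝ := (162 * max c₂ 1 + (2 * C * K * (((s : ℝ) + 1) * 2 ^ s) * max c₂ 1 ^ (s + 1) * ((s : ℝ) + 1) ^ (4 * s)) * (2 * max c₂ 1 * ((t : ℝ) + 1) ^ 8) ^ t * 2 ^ (p₀ + s + 8) * (240 : ℝ) ^ (p₀ + t + s + 6) * max c₁ 1) ^ (p + 1) *
    ((p : ℝ) + 1) ^ ((s + 16 * t + 4) * (p + 1)) with hΩ
  set sN : ℝ := schwartzNorm (p * (2 * t + p₀ + s + 12)) F with hsNdef
  have hsN : 0 ≤ sN := schwartzNorm_nonneg _ _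
  have hΘ0 : 0 ≤ Θ := by
    have : (1 : ℝ) ≤ max c₂ 1 := le_max_right _ _
    positivity
  have hc₁p : 0 ≤ c₁ ^ p := pow_nonneg hc₁.le p
  by_cases hℓ1 : ℓ ≤ 1
  · -- small scales
    have hinv1 : 1 ≤ ℓ⁻¹ := one_le_inv_iff₀.2 ⟨hℓ, hℓ1⟩
    have hmax : max 1 (ℓ⁻¹ ^ 4) = ℓ⁻¹ ^ 4 := max_eq_right (one_le_pow₀ hinv1)
    rw [hmax] at hbox
    have hterm : ∀ vz ∈ ptuIdx (sch.L k) m p,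
        ‖∑ x : Fin p → ↥(box 4 (sch.L k)),
          (∏ i, ((ptuChi (sch.a k) m p vz.1 (vz.2 i) (sch.a k • siteToE (↑(x i) : Site 4)) : ℝ) : ℂ)) *
            (SchwartzMap.smulLeftCLM ℂ
                (fun y : (Fin p → EuclideanSpace ℝ (Fin 4)) => ((ptuWeight (sch.a k) (sch.L k) p m vz.1 vz.2 y : ℝ) : ℂ)) F)
              (fun i => sch.a k • siteToE (↑(x i) : Site 4)) *
            ((centredMoment r (sch.L k) (sch.β k) p (fun i => some (q i)) (fun i => (x i : Site 4)) : ℝ) : ℂ)‖ ≤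
          Θ * ℓ ^ (4 * p + 1) * (((1 + ‖(fun i : Fin p => (WithLp.toLp 2 (fun μ : Fin 4 => max (sch.a k * ((vz.1 μ : ℝ) + cellSide m * (vz.2 i μ : ℝ))) (min 0 (sch.a k * ((vz.1 μ : ℝ) + cellSide m * ((vz.2 i μ : ℝ) + 1))))) : EuclideanSpace ℝ (Fin 4)))‖) ^ 6)⁻¹) ^ p * sN :=
      fun vz hvz => ptuFarSum_piece_small r sch k p q F hF m vz.1 vz.2 hC hK hc₂ hp hLB hFlat (hPBv vz hvz)
        (hχsuppv vz hvz) (hχbdv vz hvz) (hwCv vz hvz) (hwKv vz hvz) (hwsuppv vz hvz) (hwbdv vz hvz) (hgeov vz hvz)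
        (hsepv vz hvz) hℓ1
    have hℓid : ℓ ^ (4 * p + 1) * (ℓ⁻¹ ^ 4) ^ p = ℓ := by
      rw [← pow_mul, inv_pow, pow_succ]
      field_simp
    have hmin : min ℓ ℓ⁻¹ = ℓ := min_eq_left (hℓ1.trans hinv1)
    rw [hmin]
    calc ∑ vz ∈ ptuIdx (sch.L k) m p,
          ‖∑ x : Fin p → ↥(box 4 (sch.L k)),
          (∏ i, ((ptuChi (sch.a k) m p vz.1 (vz.2 i) (sch.a k • siteToE (↑(x i) : Site 4)) : ℝ) : ℂ)) *
            (SchwartzMap.smulLeftCLM ℂ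
                (fun y : (Fin p → EuclideanSpace ℝ (Fin 4)) => ((ptuWeight (sch.a k) (sch.L k) p m vz.1 vz.2 y : ℝ) : ℂ)) F)
              (fun i => sch.a k • siteToE (↑(x i) : Site 4)) *
            ((centredMoment r (sch.L k) (sch.β k) p (fun i => some (q i)) (fun i => (x i : Site 4)) : ℝ) : ℂ)‖
        ≤ ∑ vz ∈ ptuIdx (sch.L k) m p,
          Θ * ℓ ^ (4 * p + 1) * (((1 + ‖(fun i : Fin p => (WithLp.toLp 2 (fun μ : Fin 4 => max (sch.a k * ((vz.1 μ : ℝ) + cellSide m * (vz.2 i μ : ℝ))) (min 0 (sch.a k * ((vz.1 μ : ℝ) + cellSide m * ((vz.2 i μ : ℝ) + 1))))) : EuclideanSpace ℝ (Fin 4)))‖) ^ 6)⁻¹) ^ p * sN := Finset.sum_le_sum hterm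
      _ = Θ * ℓ ^ (4 * p + 1) * sN * ∑ vz ∈ ptuIdx (sch.L k) m p,
          (((1 + ‖(fun i : Fin p => (WithLp.toLp 2 (fun μ : Fin 4 => max (sch.a k * ((vz.1 μ : ℝ) + cellSide m * (vz.2 i μ : ℝ))) (min 0 (sch.a k * ((vz.1 μ : ℝ) + cellSide m * ((vz.2 i μ : ℝ) + 1))))) : EuclideanSpace ℝ (Fin 4)))‖) ^ 6)⁻¹) ^ p := by
          rw [Finset.mul_sum]
          exact Finset.sum_congr rfl fun vz _ => by ring
      _ ≤ Θ * ℓ ^ (4 * p + 1) * sN * ((2 * (p : ℝ) + 1) ^ 4 * (c₁ * ℓ⁻¹ ^ 4) ^ p) :=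
          mul_le_mul_of_nonneg_left hbox (by positivity)
      _ = (Θ * (2 * (p : ℝ) + 1) ^ 4 * c₁ ^ p) * (ℓ ^ (4 * p + 1) * (ℓ⁻¹ ^ 4) ^ p) * sN := by ring
      _ = (Θ * (2 * (p : ℝ) + 1) ^ 4 * c₁ ^ p) * ℓ * sN := by rw [hℓid]
      _ ≤ Ω * ℓ * sN := mul_le_mul_of_nonneg_right (mul_le_mul_of_nonneg_right hshape hℓ.le) hsN
  · -- large scales
    have hℓ1' : 1 < ℓ := lt_of_not_ge hℓ1
    have hinv1 : ℓ⁻¹ ≤ 1 := inv_le_one_of_one_le₀ hℓ1'.le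
    have hmax : max 1 (ℓ⁻¹ ^ 4) = 1 := max_eq_left (pow_le_one₀ (by positivity) hinv1)
    rw [hmax, mul_one] at hbox
    have hterm : ∀ vz ∈ ptuIdx (sch.L k) m p,
        ‖∑ x : Fin p → ↥(box 4 (sch.L k)),
          (∏ i, ((ptuChi (sch.a k) m p vz.1 (vz.2 i) (sch.a k • siteToE (↑(x i) : Site 4)) : ℝ) : ℂ)) *
            (SchwartzMap.smulLeftCLM ℂ
                (fun y : (Fin p → EuclideanSpace ℝ (Fin 4)) => ((ptuWeight (sch.a k) (sch.L k) p m vz.1 vz.2 y : ℝ) : ℂ)) F)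
              (fun i => sch.a k • siteToE (↑(x i) : Site 4)) *
            ((centredMoment r (sch.L k) (sch.β k) p (fun i => some (q i)) (fun i => (x i : Site 4)) : ℝ) : ℂ)‖ ≤
          Θ * ℓ⁻¹ * (((1 + ‖(fun i : Fin p => (WithLp.toLp 2 (fun μ : Fin 4 => max (sch.a k * ((vz.1 μ : ℝ) + cellSide m * (vz.2 i μ : ℝ))) (min 0 (sch.a k * ((vz.1 μ : ℝ) + cellSide m * ((vz.2 i μ : ℝ) + 1))))) : EuclideanSpace ℝ (Fin 4)))‖) ^ 6)⁻¹) ^ p * sN :=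
      fun vz hvz => ptuFarSum_piece_large r sch k p q F hF m vz.1 vz.2 hC hK hc₂ hp hLB hFlat (hPBv vz hvz)
        (hχsuppv vz hvz) (hχbdv vz hvz) (hwCv vz hvz) (hwKv vz hvz) (hwsuppv vz hvz) (hwbdv vz hvz) (hgeov vz hvz)
        (hsepv vz hvz) hℓ1'
    have hmin : min ℓ ℓ⁻¹ = ℓ⁻¹ := min_eq_right (hinv1.trans hℓ1'.le)
    rw [hmin]
    calc ∑ vz ∈ ptuIdx (sch.L k) m p,
          ‖∑ x : Fin p → ↥(box 4 (sch.L k)),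
          (∏ i, ((ptuChi (sch.a k) m p vz.1 (vz.2 i) (sch.a k • siteToE (↑(x i) : Site 4)) : ℝ) : ℂ)) *
            (SchwartzMap.smulLeftCLM ℂ
                (fun y : (Fin p → EuclideanSpace ℝ (Fin 4)) => ((ptuWeight (sch.a k) (sch.L k) p m vz.1 vz.2 y : ℝ) : ℂ)) F)
              (fun i => sch.a k • siteToE (↑(x i) : Site 4)) *
            ((centredMoment r (sch.L k) (sch.β k) p (fun i => some (q i)) (fun i => (x i : Site 4)) : ℝ) : ℂ)‖
        ≤ ∑ vz ∈ ptuIdx (sch.L k) m p,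
          Θ * ℓ⁻¹ * (((1 + ‖(fun i : Fin p => (WithLp.toLp 2 (fun μ : Fin 4 => max (sch.a k * ((vz.1 μ : ℝ) + cellSide m * (vz.2 i μ : ℝ))) (min 0 (sch.a k * ((vz.1 μ : ℝ) + cellSide m * ((vz.2 i μ : ℝ) + 1))))) : EuclideanSpace ℝ (Fin 4)))‖) ^ 6)⁻¹) ^ p * sN := Finset.sum_le_sum hterm
      _ = Θ * ℓ⁻¹ * sN * ∑ vz ∈ ptuIdx (sch.L k) m p,
          (((1 + ‖(fun i : Fin p => (WithLp.toLp 2 (fun μ : Fin 4 => max (sch.a k * ((vz.1 μ : ℝ) + cellSide m * (vz.2 i μ : ℝ))) (min 0 (sch.a k * ((vz.1 μ : ℝ) + cellSide m * ((vz.2 i μ : ℝ) + 1))))) : EuclideanSpace ℝ (Fin 4)))‖) ^ 6)⁻¹) ^ p := by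
          rw [Finset.mul_sum]
          exact Finset.sum_congr rfl fun vz _ => by ring
      _ ≤ Θ * ℓ⁻¹ * sN * ((2 * (p : ℝ) + 1) ^ 4 * c₁ ^ p) :=
          mul_le_mul_of_nonneg_left hbox (by positivity)
      _ = (Θ * (2 * (p : ℝ) + 1) ^ 4 * c₁ ^ p) * ℓ⁻¹ * sN := by ring
      _ ≤ Ω * ℓ⁻¹ * sN := mul_le_mul_of_nonneg_right (mul_le_mul_of_nonneg_right hshape (by positivity)) hsN

end Level

end Summit.QuantumFields.YangMills.Theorems.ContinuumLegGivenGap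

end
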